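import Summits.NavierStokesRegularity.NavierStokesRegularity.Theorems.ExtremiserTransienceNearExtremalTransiencePerFlowOfTightOrChain
import Summits.NavierStokesRegularity.NavierStokesRegularity.Theorems.ExtremiserTransienceNearExtremalTransiencePerFlowStubDissipationBudget
import HarnessLib

/-!
# Route `ExtremiserTransience`, crux `NearExtremalTransiencePerFlow` (stmt-NavierStokesRegularity-26567),
# LINE g10-β «tight-or-chain» — part D: THE LEDGER SIDE IS UNCONDITIONAL (local chain Liouville, ubiquitous-slice Liouville; crux ⇐ T♮ alone)

`--supports stmt-NavierStokesRegularity-26567` (helper).  With BOTH analytic stubs of the g10 lines landed — L1ᵘ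
`DissipationLedger.stub_uniformDissipationBudget` (prover ns-net-p2 g10, p706162) and L2 `DissipationLedger.stub_violatorDissipation`
(prover ns-net-p1 g11, p704994) — the ledger side of LINES g10-α/β closes in the kernel:

* `localChainLiouville : LocalChainLiouville` — UNCONDITIONAL: for all `K, A, g`, `η > 0`, `s < 0` there is `d > 0` such that no slice
  `W s` of a Type-I ancient mild field (constant `K`) with all-time linear local-energy growth `A` carries a level-`η` chain of thickness `g`
  and length `d` about any centre;
* `ubiquitousSliceLiouville : DissipationLedger.UbiquitousSliceLiouville` — UNCONDITIONAL (g10-α's intermediate Liouville theorem): no such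
  slice is radially ubiquitous at any thickness and any positive level (ubiquity about `0` is a chain of every length about `0`);
* `nearExtremalTransiencePerFlow_of_tightOrChain'` : `TightOrChain → NearExtremalTransiencePerFlow` — the crux from β's heart T♮ ALONE
  (and from its member-level / cluster-growth forms).

Prover seat `ns-net-p1` (g11).  HONEST FRAMING: the hearts T♮ (β), T♭ (γ), C1 (α) are NOT proved; the crux ⟨26567⟩ and NS regularity stay
OPEN; no summit is proved by a line. [folklore]
-/

noncomputable section

open scoped Topology ENNReal ContDiff
open MeasureTheory Filter Set Metric Function
open Literature.Analysis Literature.Analysis.FluidPDE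
open Summit.NavierStokesRegularity.NavierStokesRegularity.Theses.ExtremiserTransience
open Summit.NavierStokesRegularity.NavierStokesRegularity.Theorems
open Summit.NavierStokesRegularity.NavierStokesRegularity.Theorems.NearExtremalTransiencePerFlow.DissipationLedger
open Summit.NavierStokesRegularity.NavierStokesRegularity.Theorems.NearExtremalTransiencePerFlow

namespace Summit.NavierStokesRegularity.NavierStokesRegularity.Theorems.NearExtremalTransiencePerFlow.TightOrChain

-- the problem directory repeats the summit name (`NavierStokesRegularity/NavierStokesRegularity`)
set_option linter.dupNamespace false

/-- **LOCAL CHAIN LIOUVILLE, UNCONDITIONAL.**  For all `K, A, g`, `η > 0`, `s < 0` there is `d > 0` such that no slice `W s` of a Type-I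
ancient mild field (constant `K`) with all-time linear local-energy growth `A` carries a level-`η` chain of thickness `g` and length `d` about
any centre: `localChainLiouville_of_uniformDissipationBudget` fed with the landed L1ᵘ `DissipationLedger.stub_uniformDissipationBudget`
(p706162; L2 = p704994 and L3ˡᵒᶜ = `ledgerCountLocal_holds` inside). [folklore] -/
theorem localChainLiouville : LocalChainLiouville :=
  localChainLiouville_of_uniformDissipationBudget DissipationLedger.stub_uniformDissipationBudget

/-- **UBIQUITOUS-SLICE LIOUVILLE, UNCONDITIONAL** (the intermediate theorem of LINE g10-α `dissipation_ledger`, statement of record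
`DissipationLedger.UbiquitousSliceLiouville`): no slice `W s` (`s < 0`) of a Type-I ancient mild field with all-time linear local-energy
growth is radially ubiquitous at any thickness `g` and any level `η > 0` — radial ubiquity about the origin is a chain of every length about
the origin, excluded by `localChainLiouville`. [folklore] -/
theorem ubiquitousSliceLiouville : DissipationLedger.UbiquitousSliceLiouville := by
  intro K A g η W s hW hs hη hgr hub
  obtain ⟨d, -, hd⟩ := localChainLiouville K A g η s hs hη
  refine hd W 0 hW hgr ?_
  intro r hr _
  obtain ⟨z, hz, hzη⟩ := hub r hr
  exact ⟨z, by simpa using hz, hzη⟩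

/-- **THE CRUX FROM β's HEART T♮ ALONE**: `TightOrChain → NearExtremalTransiencePerFlow` (`nearExtremalTransiencePerFlow_of_tightOrChain` with
L1ᵘ discharged by p706162).  T♮ is NOT proved; the crux stays OPEN. [folklore] -/
theorem nearExtremalTransiencePerFlow_of_tightOrChain' (hT : TightOrChain) : NearExtremalTransiencePerFlow :=
  nearExtremalTransiencePerFlow_of_tightOrChain hT DissipationLedger.stub_uniformDissipationBudget

/-- The crux from the member-level heart T♮ₘₑₘ alone. [folklore] -/
theorem nearExtremalTransiencePerFlow_of_tightOrChainMembers' (hT : TightOrChainMembers) : NearExtremalTransiencePerFlow :=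
  nearExtremalTransiencePerFlow_of_tightOrChainMembers hT DissipationLedger.stub_uniformDissipationBudget

/-- The crux from cluster growth alone. [folklore] -/
theorem nearExtremalTransiencePerFlow_of_tightOrClusterGrowth' (hT : TightOrClusterGrowth) : NearExtremalTransiencePerFlow :=
  nearExtremalTransiencePerFlow_of_tightOrClusterGrowth hT DissipationLedger.stub_uniformDissipationBudget

end Summit.NavierStokesRegularity.NavierStokesRegularity.Theorems.NearExtremalTransiencePerFlow.TightOrChain

end
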